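import Mathlib
import Summits.Ventures.DiscreteObjects.Mahler.CongruentOneCoefficients

/-!
# Dobrowolski's lemma `p^{deg f} ∣ Res(f, f(X^p))` and the Dobrowolski–Mignotte length bound (venture `DiscreteObjects`, target L)

Cell `pub-namedobj`, seat `pub-namedobj-mahler` (gen 8). Framing: lottery ticket; floor = certified
bounds/negative ranges.

* `exists_expand_eq_prime_mul_add` — Dobrowolski's congruence `f(X^p) = p·T + f·f^{p-1}` in `ℤ[X]`
  (`f(X^p) ≡ f(X)^p (mod p)`, Mathlib `ZMod.expand_card`);
* `prime_pow_dvd_resultant_expand` — **Dobrowolski's Lemma** [McKee–Smyth, Lemma A.23; Dobrowolski 1979]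
  in resultant form: `p^{deg f} ∣ Res_{(d, dp)}(f, f(X^p))` for every `f ∈ ℤ[X]` and prime `p`
  (for monic irreducible `f` this integer is `∏_{i,j} (α_i^p - α_j)`); `prime_pow_le_abs_resultant_expand`
  — Cor. A.24: `p^{deg f} ≤ |Res|` when the resultant is nonzero;
* `norm_eval_le_length_mul` — `|f(β)| ≤ L(f) · max(1,|β|)^{deg f}`, `L(f) = Σ |f_i|` the length;
* `prime_le_length_mul_mahlerMeasure_pow` — the **Dobrowolski–Mignotte inequality**
  [McKee–Smyth, proof of Prop. 11.1; Mignotte 1978]: if no `p`-th power of a complex root of `f` is a root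
  of `f`, then `p ≤ L(f) · M(f)^p`;
* `two_lt_mahlerMeasure_pow_length` — with Bertrand's postulate (Mathlib): under the same separation
  hypothesis for one prime `p ∈ (2L, 4L]`, `M(f)^{4L} > 2`, i.e. `M(f) > 2^{1/(4L)}`.

The separation hypothesis holds for every `p ≥ 2` when `f` is irreducible, `f(0) ≠ 0` and `f` has no
cyclotomic factor (`pow_ne_root_of_irreducible`: if `α^p = β` were roots, the minimal polynomial `m` of `α`
would divide `m(X^p)`, the root set would be stable under `γ ↦ γ^p`, and pigeonhole would make `α` a root
of unity), giving the unconditional forms `prime_pow_le_abs_resultant_expand_of_irreducible`,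
`prime_le_length_mul_mahlerMeasure_pow_of_irreducible`, `two_lt_mahlerMeasure_pow_length_of_irreducible`.
-/

namespace Summit.Ventures.DiscreteObjects.Mahler

open Polynomial

/-- **Dobrowolski's congruence.** For a prime `p` and `f ∈ ℤ[X]`: `f(X^p) = p·T + f·f^{p-1}` for some
`T ∈ ℤ[X]` (i.e. `f(X^p) ≡ f(X)^p (mod p)`). -/
theorem exists_expand_eq_prime_mul_add (f : ℤ[X]) {p : ℕ} (hp : p.Prime) :
    ∃ T : ℤ[X], expand ℤ p f = C (p : ℤ) * T + f * f ^ (p - 1) := by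
  haveI := Fact.mk hp
  have hmap : (expand ℤ p f - f ^ p).map (Int.castRingHom (ZMod p)) = 0 := by
    rw [Polynomial.map_sub, Polynomial.map_pow, map_expand, ZMod.expand_card, sub_self]
  have hdvd : C (p : ℤ) ∣ expand ℤ p f - f ^ p := by
    rw [C_dvd_iff_dvd_coeff]
    intro i
    have h := congrArg (fun q : (ZMod p)[X] => q.coeff i) hmap
    simp only [coeff_map, eq_intCast, coeff_zero] at h
    exact (ZMod.intCast_zmod_eq_zero_iff_dvd _ p).mp h
  obtain ⟨T, hT⟩ := hdvd
  refine ⟨T, ?_⟩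
  rw [mul_pow_sub_one hp.ne_zero, ← hT]
  ring

/-- Degree bookkeeping: `deg(f^{p-1}) + deg f ≤ deg f · p`. -/
theorem natDegree_pow_pred_add_le (f : ℤ[X]) {p : ℕ} (hp : 0 < p) :
    (f ^ (p - 1)).natDegree + f.natDegree ≤ f.natDegree * p := by
  rw [natDegree_pow]
  have h : (p - 1) * f.natDegree + f.natDegree = p * f.natDegree := by
    conv_rhs => rw [← Nat.sub_add_cancel hp]
    ring
  rw [h, mul_comm]

/-- **Dobrowolski's Lemma** ([McKee–Smyth, Lemma A.23]; Dobrowolski 1979), resultant form: for every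
`f ∈ ℤ[X]` and prime `p`, `p^{deg f}` divides the resultant `Res_{(deg f, p·deg f)}(f, f(X^p))`. -/
theorem prime_pow_dvd_resultant_expand (f : ℤ[X]) {p : ℕ} (hp : p.Prime) :
    (p : ℤ) ^ f.natDegree ∣ f.resultant (expand ℤ p f) f.natDegree (f.natDegree * p) := by
  obtain ⟨T, hT⟩ := exists_expand_eq_prime_mul_add f hp
  rw [hT, resultant_add_mul_right f (C (p : ℤ) * T) (f ^ (p - 1)) f.natDegree (f.natDegree * p)
    (natDegree_pow_pred_add_le f hp.pos) le_rfl, resultant_C_mul_right]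
  exact Dvd.intro _ rfl

/-- [McKee–Smyth, Cor. A.24], resultant form: if `Res(f, f(X^p)) ≠ 0` then `p^{deg f} ≤ |Res(f, f(X^p))|`. -/
theorem prime_pow_le_abs_resultant_expand {f : ℤ[X]} {p : ℕ} (hp : p.Prime)
    (hne : f.resultant (expand ℤ p f) f.natDegree (f.natDegree * p) ≠ 0) :
    (p : ℤ) ^ f.natDegree ≤ |f.resultant (expand ℤ p f) f.natDegree (f.natDegree * p)| := by
  obtain ⟨T, hT⟩ := exists_expand_eq_prime_mul_add f hp
  have h := pow_le_abs_resultant_of_eq hT (natDegree_pow_pred_add_le f hp.pos) hne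
  rwa [Nat.abs_cast] at h

/-- **Nonvanishing.** If `f ≠ 0` and no `p`-th power of a complex root of `f` is again a root of `f`,
then `Res(f, f(X^p)) ≠ 0`. -/
theorem resultant_expand_ne_zero {f : ℤ[X]} (hf : f ≠ 0) {p : ℕ}
    (hsep : ∀ α ∈ (f.map (Int.castRingHom ℂ)).roots, ∀ β ∈ (f.map (Int.castRingHom ℂ)).roots,
      α ^ p ≠ β) :
    f.resultant (expand ℤ p f) f.natDegree (f.natDegree * p) ≠ 0 := by
  intro h
  have hinj : Function.Injective (Int.castRingHom ℂ) := (Int.castRingHom ℂ).injective_int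
  have hC := resultant_intCast_eq (f := f) (G := expand ℤ p f) (N := f.natDegree * p)
    (by rw [natDegree_expand])
  rw [h, Int.cast_zero] at hC
  have hfC : f.map (Int.castRingHom ℂ) ≠ 0 := by
    rw [Ne, Polynomial.map_eq_zero_iff hinj]; exact hf
  have hlc : (f.map (Int.castRingHom ℂ)).leadingCoeff ≠ 0 := leadingCoeff_ne_zero.mpr hfC
  rcases mul_eq_zero.mp hC.symm with h1 | h2
  · exact hlc (pow_eq_zero_iff'.mp h1).1
  · rw [Multiset.prod_eq_zero_iff, Multiset.mem_map] at h2
    obtain ⟨α, hαmem, hα0⟩ := h2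
    rw [map_expand, expand_eval] at hα0
    have hβ : α ^ p ∈ (f.map (Int.castRingHom ℂ)).roots := (mem_roots hfC).mpr hα0
    exact hsep α hαmem (α ^ p) hβ rfl

/-- **Length bound** `|f(β)| ≤ L(f) · max(1, |β|)^{deg f}`, with `L(f) = Σ_i |f_i|`. -/
theorem norm_eval_le_length_mul (f : ℤ[X]) (β : ℂ) :
    ‖(f.map (Int.castRingHom ℂ)).eval β‖ ≤
      (∑ i ∈ Finset.range (f.natDegree + 1), (|f.coeff i| : ℝ)) * max 1 ‖β‖ ^ f.natDegree := by
  have hinj : Function.Injective (Int.castRingHom ℂ) := (Int.castRingHom ℂ).injective_int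
  have hm1 : 1 ≤ max 1 ‖β‖ := le_max_left _ _
  rw [eval_eq_sum_range, natDegree_map_eq_of_injective hinj, Finset.sum_mul]
  refine (norm_sum_le _ _).trans (Finset.sum_le_sum fun i hi => ?_)
  rw [Finset.mem_range] at hi
  rw [coeff_map, eq_intCast, norm_mul, norm_pow, Complex.norm_intCast]
  refine mul_le_mul_of_nonneg_left ?_ (abs_nonneg _)
  calc ‖β‖ ^ i ≤ max 1 ‖β‖ ^ i := pow_le_pow_left₀ (norm_nonneg _) (le_max_right _ _) i
    _ ≤ max 1 ‖β‖ ^ f.natDegree := pow_le_pow_right₀ hm1 (by omega)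

/-- The length of a nonzero integer polynomial is `≥ 1`. -/
theorem one_le_length {f : ℤ[X]} (hf : f ≠ 0) :
    (1 : ℝ) ≤ ∑ i ∈ Finset.range (f.natDegree + 1), (|f.coeff i| : ℝ) := by
  have hlc : (1 : ℝ) ≤ |(f.coeff f.natDegree : ℝ)| := by
    have h : (1 : ℤ) ≤ |f.coeff f.natDegree| := Int.one_le_abs (by
      rw [coeff_natDegree]; exact leadingCoeff_ne_zero.mpr hf)
    exact_mod_cast h
  refine hlc.trans ?_
  exact Finset.single_le_sum (f := fun i => (|f.coeff i| : ℝ)) (fun i _ => abs_nonneg _)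
    (Finset.mem_range.mpr (Nat.lt_succ_self _))

/-- **Dobrowolski–Mignotte inequality** ([McKee–Smyth, proof of Prop. 11.1]; Mignotte 1978, after
Dobrowolski): for `f ∈ ℤ[X]` of degree `d ≥ 1` and a prime `p` such that no `p`-th power of a complex
root of `f` is a root of `f`, `p ≤ L(f) · M(f)^p`.  (From `p^d ≤ |Res(f, f(X^p))| =
|a|^{pd} ∏_i |f(α_i^p)| ≤ L^d M^{pd}`.) -/
theorem prime_le_length_mul_mahlerMeasure_pow {f : ℤ[X]} (hd : 1 ≤ f.natDegree) {p : ℕ} (hp : p.Prime)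
    (hsep : ∀ α ∈ (f.map (Int.castRingHom ℂ)).roots, ∀ β ∈ (f.map (Int.castRingHom ℂ)).roots,
      α ^ p ≠ β) :
    (p : ℝ) ≤ (∑ i ∈ Finset.range (f.natDegree + 1), (|f.coeff i| : ℝ)) * intMahlerMeasure f ^ p := by
  have hf : f ≠ 0 := by
    intro h; rw [h, natDegree_zero] at hd; exact absurd hd (by norm_num)
  have hinj : Function.Injective (Int.castRingHom ℂ) := (Int.castRingHom ℂ).injective_int
  set d := f.natDegree with hdd
  set L : ℝ := ∑ i ∈ Finset.range (d + 1), (|f.coeff i| : ℝ) with hL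
  have hL0 : 0 ≤ L := Finset.sum_nonneg fun i _ => abs_nonneg _
  -- `p^d ≤ |Res|`, over `ℂ`
  have hne := resultant_expand_ne_zero hf hsep
  have hlow := prime_pow_le_abs_resultant_expand hp hne
  have hlowR : (p : ℝ) ^ d ≤ ‖((f.resultant (expand ℤ p f) d (d * p) : ℤ) : ℂ)‖ := by
    rw [Complex.norm_intCast]
    exact_mod_cast hlow
  rw [resultant_intCast_eq (f := f) (G := expand ℤ p f) (N := d * p) (by rw [natDegree_expand]),
    norm_mul, norm_pow] at hlowR
  have hmp := map_multiset_prod (normHom : ℂ →*₀ ℝ)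
    (((f.map (Int.castRingHom ℂ)).roots.map ((expand ℤ p f).map (Int.castRingHom ℂ)).eval))
  rw [Multiset.map_map] at hmp
  simp only [normHom_apply, Function.comp_def] at hmp
  rw [hmp] at hlowR
  simp only [map_expand, expand_eval] at hlowR
  -- per-root bound
  have hroot : ∀ α : ℂ, ‖(f.map (Int.castRingHom ℂ)).eval (α ^ p)‖ ≤ L * max 1 ‖α‖ ^ (d * p) := by
    intro α
    refine (norm_eval_le_length_mul f (α ^ p)).trans ?_
    refine mul_le_mul_of_nonneg_left ?_ hL0
    have hm : max 1 ‖α ^ p‖ ≤ max 1 ‖α‖ ^ p := by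
      rw [norm_pow]
      exact max_le (one_le_pow₀ (le_max_left _ _))
        (pow_le_pow_left₀ (norm_nonneg _) (le_max_right _ _) p)
    calc max 1 ‖α ^ p‖ ^ d ≤ (max 1 ‖α‖ ^ p) ^ d := pow_le_pow_left₀ (by positivity) hm d
      _ = max 1 ‖α‖ ^ (d * p) := by rw [← pow_mul, mul_comm]
  have hcard : Multiset.card (f.map (Int.castRingHom ℂ)).roots = d := by
    have hsp := (IsAlgClosed.splits (f.map (Int.castRingHom ℂ))).natDegree_eq_card_roots
    rw [natDegree_map_eq_of_injective hinj] at hsp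
    exact hsp.symm
  have hprod : ((f.map (Int.castRingHom ℂ)).roots.map
      (fun α : ℂ => ‖(f.map (Int.castRingHom ℂ)).eval (α ^ p)‖)).prod ≤
      L ^ d * ((f.map (Int.castRingHom ℂ)).roots.map (fun α : ℂ => max 1 ‖α‖)).prod ^ (d * p) := by
    calc ((f.map (Int.castRingHom ℂ)).roots.map (fun α : ℂ => ‖(f.map (Int.castRingHom ℂ)).eval (α ^ p)‖)).prod
        ≤ ((f.map (Int.castRingHom ℂ)).roots.map (fun α : ℂ => L * max 1 ‖α‖ ^ (d * p))).prod :=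
          Multiset.prod_map_le_prod_map₀ _ _ (fun α _ => norm_nonneg _) (fun α _ => hroot α)
      _ = L ^ d * ((f.map (Int.castRingHom ℂ)).roots.map (fun α : ℂ => max 1 ‖α‖)).prod ^ (d * p) := by
          rw [Multiset.prod_map_mul, Multiset.prod_map_pow, Multiset.map_const', Multiset.prod_replicate,
            hcard]
  have hM : intMahlerMeasure f = ‖(f.map (Int.castRingHom ℂ)).leadingCoeff‖ *
      ((f.map (Int.castRingHom ℂ)).roots.map (fun α : ℂ => max 1 ‖α‖)).prod :=
    mahlerMeasure_eq_leadingCoeff_mul_prod_roots _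
  have hM0 : 0 ≤ intMahlerMeasure f := by
    rw [hM]; exact mul_nonneg (norm_nonneg _) (Multiset.prod_map_nonneg (fun α _ => by positivity))
  -- `p^d ≤ (L · M^p)^d`
  have key : (p : ℝ) ^ d ≤ (L * intMahlerMeasure f ^ p) ^ d := by
    calc (p : ℝ) ^ d ≤ ‖(f.map (Int.castRingHom ℂ)).leadingCoeff‖ ^ (d * p) *
          ((f.map (Int.castRingHom ℂ)).roots.map
            (fun α : ℂ => ‖(f.map (Int.castRingHom ℂ)).eval (α ^ p)‖)).prod := hlowR
      _ ≤ ‖(f.map (Int.castRingHom ℂ)).leadingCoeff‖ ^ (d * p) *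
          (L ^ d * ((f.map (Int.castRingHom ℂ)).roots.map (fun α : ℂ => max 1 ‖α‖)).prod ^ (d * p)) :=
          mul_le_mul_of_nonneg_left hprod (by positivity)
      _ = (L * intMahlerMeasure f ^ p) ^ d := by
          rw [hM, mul_pow, mul_pow, mul_pow, ← pow_mul, ← pow_mul, mul_comm p d]; ring
  exact le_of_pow_le_pow_left₀ (by omega) (mul_nonneg hL0 (pow_nonneg hM0 p)) key

/-- **Mignotte's bound, separated form** ([McKee–Smyth, Prop. 11.1]; Mignotte 1978): if `deg f ≥ 1` and
for some prime `p` with `2 L(f) < p ≤ 4 L(f)` (one exists by Bertrand's postulate) no `p`-th power of a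
root of `f` is a root of `f`, then `M(f)^{4 L(f)} > 2`, i.e. `M(f) > 2^{1/(4L)}`.  Here `L(f) = Σ |f_i|`
(as a natural number via `Int.natAbs`). -/
theorem two_lt_mahlerMeasure_pow_length {f : ℤ[X]} (hd : 1 ≤ f.natDegree) {p : ℕ} (hp : p.Prime)
    (hpL : 2 * (∑ i ∈ Finset.range (f.natDegree + 1), (f.coeff i).natAbs) < p)
    (hpU : p ≤ 4 * (∑ i ∈ Finset.range (f.natDegree + 1), (f.coeff i).natAbs))
    (hsep : ∀ α ∈ (f.map (Int.castRingHom ℂ)).roots, ∀ β ∈ (f.map (Int.castRingHom ℂ)).roots,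
      α ^ p ≠ β) :
    (2 : ℝ) < intMahlerMeasure f ^ (4 * ∑ i ∈ Finset.range (f.natDegree + 1), (f.coeff i).natAbs) := by
  have hf : f ≠ 0 := by
    intro h; rw [h, natDegree_zero] at hd; exact absurd hd (by norm_num)
  set Ln : ℕ := ∑ i ∈ Finset.range (f.natDegree + 1), (f.coeff i).natAbs with hLn
  have hcast : (∑ i ∈ Finset.range (f.natDegree + 1), (|f.coeff i| : ℝ)) = (Ln : ℝ) := by
    rw [hLn, Nat.cast_sum]
    refine Finset.sum_congr rfl fun i _ => ?_
    rw [Nat.cast_natAbs, Int.cast_abs]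
  have h := prime_le_length_mul_mahlerMeasure_pow hd hp hsep
  rw [hcast] at h
  have hM1 : 1 ≤ intMahlerMeasure f := one_le_intMahlerMeasure hf
  have hLpos : (0 : ℝ) < Ln := by
    have := one_le_length hf
    rw [hcast] at this
    linarith
  -- `M^p ≥ p / L > 2`
  have h2 : (2 : ℝ) < intMahlerMeasure f ^ p := by
    have hp' : (2 : ℝ) * Ln < p := by exact_mod_cast hpL
    by_contra hle
    push Not at hle
    have : (Ln : ℝ) * intMahlerMeasure f ^ p ≤ Ln * 2 := mul_le_mul_of_nonneg_left hle hLpos.le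
    linarith
  calc (2 : ℝ) < intMahlerMeasure f ^ p := h2
    _ ≤ intMahlerMeasure f ^ (4 * Ln) := pow_le_pow_right₀ hM1 hpU

/-- Bertrand's postulate supplies the prime needed in `two_lt_mahlerMeasure_pow_length`. -/
theorem exists_prime_in_length_window {f : ℤ[X]} (hf : f ≠ 0) :
    ∃ p : ℕ, p.Prime ∧ 2 * (∑ i ∈ Finset.range (f.natDegree + 1), (f.coeff i).natAbs) < p ∧
      p ≤ 4 * (∑ i ∈ Finset.range (f.natDegree + 1), (f.coeff i).natAbs) := by
  set Ln : ℕ := ∑ i ∈ Finset.range (f.natDegree + 1), (f.coeff i).natAbs with hLn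
  have hL : Ln ≠ 0 := by
    intro h0
    have hmem : f.natDegree ∈ Finset.range (f.natDegree + 1) := Finset.mem_range.mpr (Nat.lt_succ_self _)
    have := Finset.sum_eq_zero_iff.mp h0 f.natDegree hmem
    rw [Int.natAbs_eq_zero, coeff_natDegree] at this
    exact (leadingCoeff_ne_zero.mpr hf) this
  obtain ⟨p, hp, hlt, hle⟩ := Nat.exists_prime_lt_and_le_two_mul (2 * Ln) (by omega)
  exact ⟨p, hp, hlt, by omega⟩

/-! ### Separation: `α^p` is never a root when `f` is irreducible, `f(0) ≠ 0` and cyclotomic-free -/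

/-- **Kronecker-type separation.** If `f ∈ ℤ[X]` is irreducible with `f(0) ≠ 0` and no cyclotomic factor,
then for `p ≥ 2` no `p`-th power of a complex root of `f` is a root of `f`.  (If `α^p = β` were roots, the
minimal polynomial `m` of `α` over `ℚ` would divide `m(X^p)`, so the root set would be stable under
`γ ↦ γ^p`; by finiteness `α^{p^t} = α^{p^u}` for some `t < u`, making `α` a root of unity.) -/
theorem pow_ne_root_of_irreducible {f : ℤ[X]} (hirr : Irreducible f) (h0 : f.coeff 0 ≠ 0)
    (hcf : ∀ m : ℕ, 0 < m → ¬ cyclotomic m ℤ ∣ f) {p : ℕ} (hp : 2 ≤ p) :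
    ∀ α ∈ (f.map (Int.castRingHom ℂ)).roots, ∀ β ∈ (f.map (Int.castRingHom ℂ)).roots, α ^ p ≠ β := by
  classical
  intro α hα β hβ hαβ
  have hfC0 : f.map (Int.castRingHom ℂ) ≠ 0 := (mem_roots'.mp hα).1
  have hdeg : 0 < f.natDegree := by
    by_contra hd
    push Not at hd
    have hc := eq_C_of_natDegree_eq_zero (Nat.le_zero.mp hd)
    rw [hc, map_C, roots_C] at hα
    exact Multiset.notMem_zero _ hα
  -- roots ↔ `aeval`
  have hrootiff : ∀ γ : ℂ, γ ∈ (f.map (Int.castRingHom ℂ)).roots ↔ aeval γ f = 0 := by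
    intro γ
    rw [mem_roots hfC0, IsRoot.def, ← algebraMap_int_eq, eval_map_algebraMap]
  have hαf : aeval α f = 0 := (hrootiff α).mp hα
  -- the minimal polynomial of `α` over `ℚ` is `f` up to a scalar
  have hfQ : Irreducible (f.map (algebraMap ℤ ℚ)) :=
    ((hirr.isPrimitive hdeg.ne').irreducible_iff_irreducible_map_fraction_map (K := ℚ)).mp hirr
  have hαQ : aeval α (f.map (algebraMap ℤ ℚ)) = 0 := by rwa [aeval_map_algebraMap]
  have hmin := minpoly.eq_of_irreducible hfQ hαQ
  have hlc : (f.map (algebraMap ℤ ℚ)).leadingCoeff ≠ 0 := leadingCoeff_ne_zero.mpr hfQ.ne_zero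
  have hmiff : ∀ γ : ℂ, aeval γ (minpoly ℚ α) = 0 ↔ aeval γ f = 0 := by
    intro γ
    rw [← hmin, map_mul, aeval_C, aeval_map_algebraMap, mul_eq_zero]
    constructor
    · rintro (h | h)
      · exact h
      · exfalso
        rw [map_inv₀, inv_eq_zero, map_eq_zero] at h
        exact hlc h
    · intro h
      exact Or.inl h
  -- `m ∣ m(X^p)`, since `α^p = β` is a root of `m`
  have hβf : aeval β f = 0 := (hrootiff β).mp hβ
  have hdvd : minpoly ℚ α ∣ (minpoly ℚ α).comp (X ^ p) := by
    apply minpoly.dvd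
    rw [aeval_comp, aeval_X_pow, hαβ]
    exact (hmiff β).mpr hβf
  -- the root set is stable under `γ ↦ γ^p`
  have hclos : ∀ γ ∈ (f.map (Int.castRingHom ℂ)).roots, γ ^ p ∈ (f.map (Int.castRingHom ℂ)).roots := by
    intro γ hγ
    have h1 : aeval γ (minpoly ℚ α) = 0 := (hmiff γ).mpr ((hrootiff γ).mp hγ)
    obtain ⟨q, hq⟩ := hdvd
    have h2 : aeval γ ((minpoly ℚ α).comp (X ^ p)) = 0 := by rw [hq, map_mul, h1, zero_mul]
    rw [aeval_comp, aeval_X_pow] at h2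
    exact (hrootiff _).mpr ((hmiff _).mp h2)
  have hiter : ∀ t : ℕ, α ^ (p ^ t) ∈ (f.map (Int.castRingHom ℂ)).roots := by
    intro t
    induction t with
    | zero => simpa using hα
    | succ t ih =>
      rw [pow_succ, pow_mul]
      exact hclos _ ih
  -- pigeonhole
  let g : ℕ → {x // x ∈ (f.map (Int.castRingHom ℂ)).roots.toFinset} :=
    fun t => ⟨α ^ (p ^ t), Multiset.mem_toFinset.mpr (hiter t)⟩
  obtain ⟨t, u, htu, hg⟩ := Finite.exists_ne_map_eq_of_infinite g
  have hval : α ^ (p ^ t) = α ^ (p ^ u) := congrArg Subtype.val hg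
  have hα0 : α ≠ 0 := by
    intro h
    rw [h, aeval_def, eval₂_at_zero, algebraMap_int_eq, eq_intCast, Int.cast_eq_zero] at hαf
    exact h0 hαf
  -- from `α^{p^t} = α^{p^u}` with `t ≠ u`: `α^{|p^u - p^t|} = 1`
  have key : ∀ t u : ℕ, t < u → α ^ (p ^ t) = α ^ (p ^ u) → False := by
    intro t u htu h
    have hlt : p ^ t < p ^ u := Nat.pow_lt_pow_right (by omega) htu
    have hsplit : α ^ (p ^ u) = α ^ (p ^ t) * α ^ (p ^ u - p ^ t) := by
      rw [← pow_add, Nat.add_sub_cancel' hlt.le]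
    have hone : α ^ (p ^ u - p ^ t) = 1 := by
      have hne : α ^ (p ^ t) ≠ 0 := pow_ne_zero _ hα0
      have : α ^ (p ^ t) * α ^ (p ^ u - p ^ t) = α ^ (p ^ t) * 1 := by rw [← hsplit, mul_one, h]
      exact mul_left_cancel₀ hne this
    exact pow_ne_one_of_cyclotomicFree hcf hαf (N := p ^ u - p ^ t) (by omega) hone
  rcases Nat.lt_or_gt_of_ne htu with h | h
  · exact key t u h hval
  · exact key u t h hval.symm

/-- **[McKee–Smyth, Cor. A.24] (Dobrowolski), unconditional form.** For `f ∈ ℤ[X]` irreducible with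
`f(0) ≠ 0` and no cyclotomic factor, and every prime `p`: `p^{deg f} ≤ |Res(f, f(X^p))|`. -/
theorem prime_pow_le_abs_resultant_expand_of_irreducible {f : ℤ[X]} (hirr : Irreducible f)
    (h0 : f.coeff 0 ≠ 0) (hcf : ∀ m : ℕ, 0 < m → ¬ cyclotomic m ℤ ∣ f) {p : ℕ} (hp : p.Prime) :
    (p : ℤ) ^ f.natDegree ≤ |f.resultant (expand ℤ p f) f.natDegree (f.natDegree * p)| :=
  prime_pow_le_abs_resultant_expand hp
    (resultant_expand_ne_zero hirr.ne_zero (pow_ne_root_of_irreducible hirr h0 hcf hp.two_le))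

/-- **Mignotte's theorem** ([McKee–Smyth, Prop. 11.1]; Mignotte 1978): an irreducible `f ∈ ℤ[X]` of
degree `≥ 1` with `f(0) ≠ 0` and no cyclotomic factor satisfies `M(f)^{4 L(f)} > 2`, i.e.
`M(f) > 2^{1/(4 L(f))}`, where `L(f) = Σ |f_i|` is the length. -/
theorem two_lt_mahlerMeasure_pow_length_of_irreducible {f : ℤ[X]} (hirr : Irreducible f)
    (hd : 1 ≤ f.natDegree) (h0 : f.coeff 0 ≠ 0) (hcf : ∀ m : ℕ, 0 < m → ¬ cyclotomic m ℤ ∣ f) :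
    (2 : ℝ) < intMahlerMeasure f ^ (4 * ∑ i ∈ Finset.range (f.natDegree + 1), (f.coeff i).natAbs) := by
  obtain ⟨p, hp, hlt, hle⟩ := exists_prime_in_length_window hirr.ne_zero
  exact two_lt_mahlerMeasure_pow_length hd hp hlt hle (pow_ne_root_of_irreducible hirr h0 hcf hp.two_le)

/-- For every prime `p`: `p ≤ L(f) · M(f)^p` for irreducible cyclotomic-free `f` with `f(0) ≠ 0`,
`deg f ≥ 1` (the Dobrowolski–Mignotte inequality, unconditional form). -/
theorem prime_le_length_mul_mahlerMeasure_pow_of_irreducible {f : ℤ[X]} (hirr : Irreducible f)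
    (hd : 1 ≤ f.natDegree) (h0 : f.coeff 0 ≠ 0) (hcf : ∀ m : ℕ, 0 < m → ¬ cyclotomic m ℤ ∣ f)
    {p : ℕ} (hp : p.Prime) :
    (p : ℝ) ≤ (∑ i ∈ Finset.range (f.natDegree + 1), (|f.coeff i| : ℝ)) * intMahlerMeasure f ^ p :=
  prime_le_length_mul_mahlerMeasure_pow hd hp (pow_ne_root_of_irreducible hirr h0 hcf hp.two_le)

end Summit.Ventures.DiscreteObjects.Mahler
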